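import Literature.Computability.QuantumComplexity.QSimSign
import Literature.Computability.Cryptography.QuantumCircuitDescFP
import Literature.Computability.Complexity.Transducers
import HarnessLib

/-!
# Aaronson–Ambainis Theorem 25 in `FP`, I: the lexer of QSIM instance codes

Topic `Literature/Computability/QuantumComplexity`; first of the files discharging the residual
named fact `AaronsonAmbainis2018_thm25_sign_encodeFP` of `ForrelationThm25Sign.lean` — the
instance map `thm25SignInstance` of AA Theorem 25 (QSIM over the sign basis `{H, Z, CZ, CCZ}` `→`
explicit `k`-fold FORRELATION), on codes, is computable in polynomial time (S. Aaronson,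
A. Ambainis, *Forrelation*, SIAM J. Comput. 47 (2018) = arXiv:1411.5729, §6, Thm. 25:
"polynomial-time reducible"; proof, p. 27: the reduction is a gate-by-gate transcription).

The machine is the composite of two polynomial-time string functions (`comp_mem_FP`):

* a **finite-state transducer** (this file; `FST`, `Transducers.lean`: every finite-state
  transduction is in `FP`, `FST.polyTimeComputable_eval`) that *lexes* the code
  `QSimSignInstance.encode (n, Q) = boolPair 1ⁿ (encList (gate codes))` — a nest of bit-doubled
  pairings (`boolPair`, Arora–Barak 2009, §0.1) — into a flat stream: the unary numeral `1ⁿ`, a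
  `0`, and then, per gate and in *postfix* order, three-bit tokens: the bits of the binary wire
  numerals (`tokB b = 00b`), an end-of-numeral token (`tokWEND = 010`) per wire, and finally the
  kind of the gate (`H`, `Z`, `CZ`, `CCZ`: `100, 101, 110, 111`; oracle gates, outside the
  promise: `011`);
* a structured stack program (`StackPrograms.lean`) interpreting that stream (sequel files).

Main result: `Thm25Lex.eval_encode` — on the code of an instance the lexer outputs
`1ⁿ ++ 0 :: (gates.flatMap gateToks)` with `gateToks` the explicit token list of a gate.

## References

* S. Aaronson, A. Ambainis, *Forrelation: a problem that optimally separates quantum from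
  classical computing*, SIAM J. Comput. 47 (2018) 982–1038; arXiv:1411.5729, §6, Thm. 25 (p. 27).
* S. Arora, B. Barak, *Computational Complexity: A Modern Approach*, CUP 2009, §0.1 (pairing,
  binary numerals), §1.3 (polynomial time is closed under composition), §6.1 (circuit codes).
* J. E. Hopcroft, J. D. Ullman, *Introduction to Automata Theory, Languages, and Computation*,
  Addison-Wesley 1979, §2.7 (Mealy machines).
-/

namespace Literature.Computability.QuantumComplexity

open _root_.Computability Complexity Cryptography

namespace Thm25Lex

/-! ### Bit repetition -/

/-- `rep m u`: every bit of `u` repeated `m` times (`rep 2 = SProg.dbl`, the first component of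
`boolPair`). [cite: AroraBarak2009, §0.1 (pairing of strings)] -/
def rep (m : ℕ) (u : List Bool) : List Bool := u.flatMap fun b => List.replicate m b

/-- `rep` of the empty string. [folklore] -/
@[simp] theorem rep_nil (m : ℕ) : rep m [] = [] := rfl

/-- `rep` of a cons. [folklore] -/
@[simp] theorem rep_cons (m : ℕ) (b : Bool) (u : List Bool) : rep m (b :: u) = List.replicate m b ++ rep m u := rfl

/-- `rep` of a concatenation. [folklore] -/
@[simp] theorem rep_append (m : ℕ) (u v : List Bool) : rep m (u ++ v) = rep m u ++ rep m v := by
  simp [rep, List.flatMap_append]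

/-- Repeating twice is doubling. [folklore] -/
theorem dbl_eq_rep (u : List Bool) : SProg.dbl u = rep 2 u := rfl

/-- Repeating a constant run. [folklore] -/
theorem rep_replicate (m k : ℕ) (b : Bool) : rep m (List.replicate k b) = List.replicate (k * m) b := by
  induction k with
  | zero => simp
  | succ k ih => rw [List.replicate_succ, rep_cons, ih, Nat.succ_mul, Nat.add_comm, List.replicate_add]

/-- Iterated repetition multiplies. [folklore] -/
theorem rep_rep (m m' : ℕ) (u : List Bool) : rep m (rep m' u) = rep (m' * m) u := by
  induction u with
  | nil => rfl
  | cons b u ih => rw [rep_cons, rep_cons, rep_append, ih, rep_replicate]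

/-- Length of a repetition. [folklore] -/
@[simp] theorem length_rep (m : ℕ) (u : List Bool) : (rep m u).length = m * u.length := by
  induction u with
  | nil => simp
  | cons b u ih => simp [ih, Nat.mul_succ, Nat.add_comm]

/-- `boolPair x y = rep 2 x ++ 01 ++ y`. [cite: AroraBarak2009, §0.1 (pairing of strings)] -/
theorem boolPair_eq_rep (x y : List Bool) : boolPair x y = rep 2 x ++ [false, true] ++ y := rfl

/-- Doubling a pair: `rep 2 (boolPair x y) = rep 4 x ++ 0011 ++ rep 2 y`. [folklore] -/
theorem rep_two_boolPair (x y : List Bool) :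
    rep 2 (boolPair x y) = rep 4 x ++ [false, false, true, true] ++ rep 2 y := by
  rw [boolPair_eq_rep, rep_append, rep_append, rep_rep]; rfl

/-- Doubling a coded list. [folklore] -/
theorem rep_two_encList (l : List (List Bool)) :
    rep 2 (encList l) = l.flatMap fun a => rep 4 a ++ [false, false, true, true] := by
  induction l with
  | nil => rfl
  | cons a l ih => rw [encList_cons, rep_two_boolPair, ih, List.flatMap_cons, List.append_assoc]

/-- The unary numeral is a run of `true`s. [folklore] -/
theorem unaryEncodeNat_eq_replicate : ∀ n : ℕ, unaryEncodeNat n = List.replicate n true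
  | 0 => rfl
  | n + 1 => by rw [unaryEncodeNat, unaryEncodeNat_eq_replicate n, List.replicate_succ]

/-! ### Tokens -/

/-- Token: a bit of a wire numeral. [folklore] -/
def tokB (b : Bool) : List Bool := [false, false, b]
/-- Token: end of a wire numeral. [folklore] -/
def tokWEND : List Bool := [false, true, false]
/-- Token: an oracle gate (outside the promise) or a malformed gate. [folklore] -/
def tokKOR : List Bool := [false, true, true]
/-- Token: a Hadamard gate. [folklore] -/
def tokKH : List Bool := [true, false, false]
/-- Token: a `Z` gate. [folklore] -/
def tokKZ : List Bool := [true, false, true]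
/-- Token: a `CZ` gate. [folklore] -/
def tokKCZ : List Bool := [true, true, false]
/-- Token: a `CCZ` gate. [folklore] -/
def tokKCCZ : List Bool := [true, true, true]

/-- The kind token of a gate symbol of the sign basis. [folklore] -/
def kindTokOf : HSignOp → List Bool
  | .H => tokKH
  | .Z => tokKZ
  | .CZ => tokKCZ
  | .CCZ => tokKCCZ

/-- The tokens of the bits of a numeral `u`. [folklore] -/
def bitsTok (u : List Bool) : List Bool := u.flatMap tokB

/-- `bitsTok` of nil. [folklore] -/
@[simp] theorem bitsTok_nil : bitsTok [] = [] := rfl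
/-- `bitsTok` of cons. [folklore] -/
@[simp] theorem bitsTok_cons (b : Bool) (u : List Bool) : bitsTok (b :: u) = tokB b ++ bitsTok u := rfl

/-- The tokens of a wire: its numeral's bits, then the end-of-numeral token. [folklore] -/
def wireTok (w : ℕ) : List Bool := bitsTok (encodeNat w) ++ tokWEND

variable {n : ℕ}

/-- **The token block of a gate** (postfix: wires, then kind). [cite: AroraBarak2009, §6.1 (descriptions of circuits)] -/
noncomputable def gateToks : QGate hSign n → List Bool
  | .gate g e => ((List.ofFn fun i => (e i : ℕ)).flatMap wireTok) ++ kindTokOf g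
  | .oracle _ _ => tokKOR

/-! ### The transducer -/

/-- Phases: unary prefix, gate list (expecting a tag), symbol numeral, arity, wires, skipping an
oracle gate, dead (malformed input). [folklore] -/
inductive Ph
  | pre | gl | sym | ar | wi | osk | dead
  deriving DecidableEq, Fintype

/-- The symbol accumulator: the numeral bits read so far (`[]`, `1`, `0`, `01`, `11`, other).
[folklore] -/
inductive SymV
  | s0 | s1 | sF | s2 | s3 | bad
  deriving DecidableEq, Fintype

/-- Reading one more bit of the symbol numeral. [folklore] -/
def SymV.push : SymV → Bool → SymV
  | .s0, true => .s1
  | .s0, false => .sF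
  | .s1, true => .s3
  | .sF, true => .s2
  | _, _ => .bad

/-- The kind token of an accumulated symbol (`H = 0 = []`, `Z = 1`, `CZ = 01`, `CCZ = 11`).
[folklore] -/
def SymV.tok : SymV → List Bool
  | .s0 => tokKH
  | .s1 => tokKZ
  | .s2 => tokKCZ
  | .s3 => tokKCCZ
  | .sF => tokKOR
  | .bad => tokKOR

/-- Two-bit cells of a doubled stream: `00`, `11`, the separator `01`, malformed `10`. [folklore] -/
inductive Cell
  | c0 | c1 | sep | bad
  deriving DecidableEq

/-- The cell formed by two bits. [folklore] -/
def cellOf : Bool → Bool → Cell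
  | false, false => .c0
  | true, true => .c1
  | false, true => .sep
  | true, false => .bad

/-- The state of the lexer: phase, pending first bit of a cell, pending first cell of a
four-bit group (`some b` = the cell `bb`), symbol accumulator. [folklore] -/
structure LS where
  /-- phase -/
  ph : Ph
  /-- pending first bit of the current cell -/
  hb : Option Bool
  /-- pending first cell of the current group -/
  hc : Option Bool
  /-- symbol accumulator -/
  sv : SymV
  deriving DecidableEq, Fintype

/-- The kind token emitted at the end of a gate: by the accumulated symbol if the gate reached
its wire list, `tokKOR` otherwise (oracle or malformed). [folklore] -/
def kindTok (ph : Ph) (sv : SymV) : List Bool := if ph = Ph.wi then sv.tok else tokKOR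

/-- A data bit inside a gate: a symbol bit, an arity bit (ignored), a wire bit (emitted), or a
bit of an oracle gate (ignored). [folklore] -/
def dataStep (ph : Ph) (sv : SymV) (b : Bool) : LS × List Bool :=
  match ph with
  | .sym => (⟨.sym, none, none, sv.push b⟩, [])
  | .wi => (⟨.wi, none, none, sv⟩, tokB b)
  | ph => (⟨ph, none, none, sv⟩, [])

/-- A group separator `0011` inside a gate: next field. [folklore] -/
def gsepStep (ph : Ph) (sv : SymV) : LS × List Bool :=
  match ph with
  | .sym => (⟨.ar, none, none, sv⟩, [])
  | .ar => (⟨.wi, none, none, sv⟩, [])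
  | .wi => (⟨.wi, none, none, sv⟩, tokWEND)
  | ph => (⟨ph, none, none, sv⟩, [])

/-- Processing a complete cell (the pending bit already consumed). [folklore] -/
def cellStep (ph : Ph) (hc : Option Bool) (sv : SymV) (c : Cell) : LS × List Bool :=
  match ph with
  | .pre =>
    match c with
    | .c1 => (⟨.pre, none, none, sv⟩, [true])
    | .sep => (⟨.gl, none, none, sv⟩, [false])
    | _ => (⟨.dead, none, none, sv⟩, [])
  | .gl =>
    match c with
    | .c0 => (⟨.sym, none, none, .s0⟩, [])
    | .c1 => (⟨.osk, none, none, sv⟩, [])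
    | _ => (⟨.dead, none, none, sv⟩, [])
  | .dead => (⟨.dead, none, none, sv⟩, [])
  | ph =>
    match hc, c with
    | none, .sep => (⟨.gl, none, none, sv⟩, kindTok ph sv)
    | none, .c0 => (⟨ph, none, some false, sv⟩, [])
    | none, .c1 => (⟨ph, none, some true, sv⟩, [])
    | none, .bad => (⟨.dead, none, none, sv⟩, [])
    | some false, .c0 => dataStep ph sv false
    | some true, .c1 => dataStep ph sv true
    | some false, .c1 => gsepStep ph sv
    | some _, _ => (⟨.dead, none, none, sv⟩, [])

/-- One input bit: store the first bit of a cell, or complete the cell. [folklore] -/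
def step (s : LS) (x : Bool) : LS × List Bool :=
  match s.hb with
  | none => (⟨s.ph, some x, s.hc, s.sv⟩, [])
  | some y => cellStep s.ph s.hc s.sv (cellOf y x)

/-- **The lexer** of QSIM instance codes (no front word, body always kept). [cite: AroraBarak2009, §6.1 (descriptions of circuits)] -/
def lexT : FST LS Bool Bool where
  init := ⟨.pre, none, none, .s0⟩
  step := step
  front _ := []
  keep _ := true

/-- The lexer is a polynomial-time string function. [cite: AroraBarak2009, §1.3] -/
theorem lexT_eval_mem_FP : lexT.eval ∈ FP := lexT.polyTimeComputable_eval

/-! ### Running the lexer: cells and segments -/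

/-- Two input bits form a cell. [folklore] -/
theorem run_cell (ph : Ph) (hc : Option Bool) (sv : SymV) (y x : Bool) (l : List Bool) :
    lexT.run ⟨ph, none, hc, sv⟩ (y :: x :: l) =
      ((lexT.run (cellStep ph hc sv (cellOf y x)).1 l).1,
        (cellStep ph hc sv (cellOf y x)).2 ++ (lexT.run (cellStep ph hc sv (cellOf y x)).1 l).2) := by
  rfl

/-- The unary prefix is copied. [folklore] -/
theorem run_pre_replicate (sv : SymV) (m : ℕ) (l : List Bool) :
    lexT.run ⟨.pre, none, none, sv⟩ (rep 2 (List.replicate m true) ++ l) =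
      ((lexT.run ⟨.pre, none, none, sv⟩ l).1, List.replicate m true ++ (lexT.run ⟨.pre, none, none, sv⟩ l).2) := by
  induction m with
  | zero => simp
  | succ m ih =>
    rw [List.replicate_succ, rep_cons, List.append_assoc]
    change lexT.run ⟨.pre, none, none, sv⟩ (true :: true :: (rep 2 (List.replicate m true) ++ l)) = _
    rw [run_cell]
    change ((lexT.run ⟨.pre, none, none, sv⟩ (rep 2 (List.replicate m true) ++ l)).1,
      [true] ++ (lexT.run ⟨.pre, none, none, sv⟩ (rep 2 (List.replicate m true) ++ l)).2) = _
    rw [ih]; rfl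

/-- The separator after the prefix. [folklore] -/
theorem run_pre_sep (sv : SymV) (l : List Bool) :
    lexT.run ⟨.pre, none, none, sv⟩ (false :: true :: l) =
      ((lexT.run ⟨.gl, none, none, sv⟩ l).1, false :: (lexT.run ⟨.gl, none, none, sv⟩ l).2) := by
  rw [run_cell]; rfl

/-- The tag cell of a proper gate. [folklore] -/
theorem run_gl_gate (sv : SymV) (l : List Bool) :
    lexT.run ⟨.gl, none, none, sv⟩ (false :: false :: l) = lexT.run ⟨.sym, none, none, .s0⟩ l := by
  rw [run_cell]; rfl

/-- The tag cell of an oracle gate. [folklore] -/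
theorem run_gl_oracle (sv : SymV) (l : List Bool) :
    lexT.run ⟨.gl, none, none, sv⟩ (true :: true :: l) = lexT.run ⟨.osk, none, none, sv⟩ l := by
  rw [run_cell]; rfl

/-- A data bit (four equal input bits) in the symbol phase updates the accumulator. [folklore] -/
theorem run_sym_data (sv : SymV) (b : Bool) (l : List Bool) :
    lexT.run ⟨.sym, none, none, sv⟩ (b :: b :: b :: b :: l) = lexT.run ⟨.sym, none, none, sv.push b⟩ l := by
  rw [run_cell]; cases b <;> rfl

/-- A data bit in the arity phase is ignored. [folklore] -/
theorem run_ar_data (sv : SymV) (b : Bool) (l : List Bool) :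
    lexT.run ⟨.ar, none, none, sv⟩ (b :: b :: b :: b :: l) = lexT.run ⟨.ar, none, none, sv⟩ l := by
  rw [run_cell]; cases b <;> rfl

/-- A data bit while skipping an oracle gate is ignored. [folklore] -/
theorem run_osk_data (sv : SymV) (b : Bool) (l : List Bool) :
    lexT.run ⟨.osk, none, none, sv⟩ (b :: b :: b :: b :: l) = lexT.run ⟨.osk, none, none, sv⟩ l := by
  rw [run_cell]; cases b <;> rfl

/-- A data bit in the wire phase is emitted as a token. [folklore] -/
theorem run_wi_data (sv : SymV) (b : Bool) (l : List Bool) :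
    lexT.run ⟨.wi, none, none, sv⟩ (b :: b :: b :: b :: l) =
      ((lexT.run ⟨.wi, none, none, sv⟩ l).1, tokB b ++ (lexT.run ⟨.wi, none, none, sv⟩ l).2) := by
  rw [run_cell]; cases b <;> rfl

/-- The whole symbol numeral. [folklore] -/
theorem run_sym_rep (sv : SymV) (u : List Bool) (l : List Bool) :
    lexT.run ⟨.sym, none, none, sv⟩ (rep 4 u ++ l) = lexT.run ⟨.sym, none, none, u.foldl SymV.push sv⟩ l := by
  induction u generalizing sv with
  | nil => rfl
  | cons b u ih =>
    rw [rep_cons, List.append_assoc]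
    change lexT.run ⟨.sym, none, none, sv⟩ (b :: b :: b :: b :: (rep 4 u ++ l)) = _
    rw [run_sym_data, ih]; rfl

/-- A doubled-doubled segment in the arity phase is skipped. [folklore] -/
theorem run_ar_rep (sv : SymV) (u : List Bool) (l : List Bool) :
    lexT.run ⟨.ar, none, none, sv⟩ (rep 4 u ++ l) = lexT.run ⟨.ar, none, none, sv⟩ l := by
  induction u with
  | nil => rfl
  | cons b u ih =>
    rw [rep_cons, List.append_assoc]
    change lexT.run ⟨.ar, none, none, sv⟩ (b :: b :: b :: b :: (rep 4 u ++ l)) = _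
    rw [run_ar_data, ih]

/-- A doubled-doubled segment of an oracle gate is skipped. [folklore] -/
theorem run_osk_rep (sv : SymV) (u : List Bool) (l : List Bool) :
    lexT.run ⟨.osk, none, none, sv⟩ (rep 4 u ++ l) = lexT.run ⟨.osk, none, none, sv⟩ l := by
  induction u with
  | nil => rfl
  | cons b u ih =>
    rw [rep_cons, List.append_assoc]
    change lexT.run ⟨.osk, none, none, sv⟩ (b :: b :: b :: b :: (rep 4 u ++ l)) = _
    rw [run_osk_data, ih]

/-- A wire numeral is emitted bit by bit. [folklore] -/
theorem run_wi_rep (sv : SymV) (u : List Bool) (l : List Bool) :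
    lexT.run ⟨.wi, none, none, sv⟩ (rep 4 u ++ l) =
      ((lexT.run ⟨.wi, none, none, sv⟩ l).1, bitsTok u ++ (lexT.run ⟨.wi, none, none, sv⟩ l).2) := by
  induction u with
  | nil => simp
  | cons b u ih =>
    rw [rep_cons, List.append_assoc]
    change lexT.run ⟨.wi, none, none, sv⟩ (b :: b :: b :: b :: (rep 4 u ++ l)) = _
    rw [run_wi_data, ih, bitsTok_cons, List.append_assoc]

/-- The group separator ends the symbol field. [folklore] -/
theorem run_sym_gsep (sv : SymV) (l : List Bool) :
    lexT.run ⟨.sym, none, none, sv⟩ (false :: false :: true :: true :: l) = lexT.run ⟨.ar, none, none, sv⟩ l := by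
  rw [run_cell]; rfl

/-- The group separator ends the arity field. [folklore] -/
theorem run_ar_gsep (sv : SymV) (l : List Bool) :
    lexT.run ⟨.ar, none, none, sv⟩ (false :: false :: true :: true :: l) = lexT.run ⟨.wi, none, none, sv⟩ l := by
  rw [run_cell]; rfl

/-- The group separator inside an oracle gate is skipped. [folklore] -/
theorem run_osk_gsep (sv : SymV) (l : List Bool) :
    lexT.run ⟨.osk, none, none, sv⟩ (false :: false :: true :: true :: l) = lexT.run ⟨.osk, none, none, sv⟩ l := by
  rw [run_cell]; rfl

/-- The group separator after a wire numeral is the end-of-numeral token. [folklore] -/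
theorem run_wi_gsep (sv : SymV) (l : List Bool) :
    lexT.run ⟨.wi, none, none, sv⟩ (false :: false :: true :: true :: l) =
      ((lexT.run ⟨.wi, none, none, sv⟩ l).1, tokWEND ++ (lexT.run ⟨.wi, none, none, sv⟩ l).2) := by
  rw [run_cell]; rfl

/-- The pair separator `01` at a group boundary ends the gate: the kind token. [folklore] -/
theorem run_wi_end (sv : SymV) (l : List Bool) :
    lexT.run ⟨.wi, none, none, sv⟩ (false :: true :: l) =
      ((lexT.run ⟨.gl, none, none, sv⟩ l).1, sv.tok ++ (lexT.run ⟨.gl, none, none, sv⟩ l).2) := by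
  rw [run_cell]; rfl

/-- The pair separator `01` at a group boundary ends an oracle gate. [folklore] -/
theorem run_osk_end (sv : SymV) (l : List Bool) :
    lexT.run ⟨.osk, none, none, sv⟩ (false :: true :: l) =
      ((lexT.run ⟨.gl, none, none, sv⟩ l).1, tokKOR ++ (lexT.run ⟨.gl, none, none, sv⟩ l).2) := by
  rw [run_cell]; rfl

/-! ### Running the lexer: fields, gates, instances -/

/-- The list of wire numerals of a gate is emitted as wire tokens. [folklore] -/
theorem run_wi_wires (sv : SymV) (ws : List ℕ) (l : List Bool) :
    lexT.run ⟨.wi, none, none, sv⟩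
        ((ws.flatMap fun w => rep 4 (encodeNat w) ++ [false, false, true, true]) ++ l) =
      ((lexT.run ⟨.wi, none, none, sv⟩ l).1, ws.flatMap wireTok ++ (lexT.run ⟨.wi, none, none, sv⟩ l).2) := by
  induction ws with
  | nil => simp
  | cons w ws ih =>
    rw [List.flatMap_cons, List.append_assoc, List.append_assoc, run_wi_rep]
    simp only [List.cons_append, List.nil_append]
    rw [run_wi_gsep, ih, List.flatMap_cons, wireTok]
    simp only [List.append_assoc]

/-- The wire numerals of an oracle gate are skipped. [folklore] -/
theorem run_osk_wires (sv : SymV) (ws : List ℕ) (l : List Bool) :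
    lexT.run ⟨.osk, none, none, sv⟩
        ((ws.flatMap fun w => rep 4 (encodeNat w) ++ [false, false, true, true]) ++ l) =
      lexT.run ⟨.osk, none, none, sv⟩ l := by
  induction ws with
  | nil => simp
  | cons w ws ih =>
    rw [List.flatMap_cons, List.append_assoc, List.append_assoc, run_osk_rep]
    simp only [List.cons_append, List.nil_append]
    rw [run_osk_gsep, ih]

/-- The symbol numerals of the four gate symbols drive the accumulator to the right kind.
[folklore] -/
theorem tok_foldl_encode (g : hSign.Op) :
    ((encodeNat (Encodable.encode g)).foldl SymV.push .s0).tok = kindTokOf g := by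
  cases g <;> rfl

/-- The doubled wire-list code of a gate. [folklore] -/
theorem rep_two_encode_wires (ws : List ℕ) :
    rep 2 (encodingListNatBool.encode ws) =
      rep 4 (unaryEncodeNat ws.length) ++ [false, false, true, true] ++
        ws.flatMap fun w => rep 4 (encodeNat w) ++ [false, false, true, true] := by
  change rep 2 (boolPair (unaryEncodeNat ws.length)
    (ws.foldr (fun a acc => boolPair (encodeNat a) acc) [])) = _
  rw [rep_two_boolPair]
  congr 1
  induction ws with
  | nil => rfl
  | cons w ws ih => rw [List.foldr_cons, rep_two_boolPair, ih, List.flatMap_cons, List.append_assoc]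

/-- **One proper gate**: its doubled code followed by the pair separator lexes to its token
block, and the lexer is back at the gate list. [cite: AroraBarak2009, §6.1 (descriptions of circuits)] -/
theorem run_gl_gateCode (sv : SymV) (g : hSign.Op) (e : Fin (hSign.arity g) ↪ Fin n) (l : List Bool) :
    ∃ sv' : SymV, lexT.run ⟨.gl, none, none, sv⟩
        (rep 2 (QGate.encode (QGate.gate (G := hSign) (n := n) g e)) ++ [false, true] ++ l) =
      ((lexT.run ⟨.gl, none, none, sv'⟩ l).1,
        gateToks (QGate.gate (G := hSign) (n := n) g e) ++ (lexT.run ⟨.gl, none, none, sv'⟩ l).2) := by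
  refine ⟨(encodeNat (Encodable.encode g)).foldl SymV.push .s0, ?_⟩
  have hcode : QGate.encode (QGate.gate (G := hSign) (n := n) g e) = false :: boolPair (encodeNat (Encodable.encode g))
      (encodingListNatBool.encode (List.ofFn fun i => (e i : ℕ))) := rfl
  rw [hcode, rep_cons, rep_two_boolPair, rep_two_encode_wires]
  simp only [List.replicate, List.cons_append, List.append_assoc, List.nil_append]
  rw [run_gl_gate, run_sym_rep, run_sym_gsep, run_ar_rep, run_ar_gsep, run_wi_wires, run_wi_end, tok_foldl_encode,
    gateToks, List.append_assoc]

/-- **One oracle gate** lexes to the single token `tokKOR`. [cite: AroraBarak2009, §6.1 (descriptions of circuits)] -/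
theorem run_gl_oracleCode (sv : SymV) (m : ℕ) (e : Fin (m + 1) ↪ Fin n) (l : List Bool) :
    lexT.run ⟨.gl, none, none, sv⟩ (rep 2 (QGate.encode (QGate.oracle (G := hSign) m e)) ++ [false, true] ++ l) =
      ((lexT.run ⟨.gl, none, none, sv⟩ l).1,
        gateToks (QGate.oracle (G := hSign) m e) ++ (lexT.run ⟨.gl, none, none, sv⟩ l).2) := by
  have hcode : QGate.encode (QGate.oracle (G := hSign) m e) = true :: boolPair (encodeNat m)
      (encodingListNatBool.encode (List.ofFn fun i => (e i : ℕ))) := rfl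
  rw [hcode, rep_cons, rep_two_boolPair, rep_two_encode_wires]
  simp only [List.replicate, List.cons_append, List.append_assoc, List.nil_append]
  rw [run_gl_oracle, run_osk_rep, run_osk_gsep, run_osk_rep, run_osk_gsep, run_osk_wires, run_osk_end, gateToks]

/-- **A whole gate list** lexes to the concatenation of the token blocks. [cite: AroraBarak2009, §6.1 (descriptions of circuits)] -/
theorem run_gl_gates (gs : List (QGate hSign n)) :
    ∀ sv : SymV, ∃ sv' : SymV, lexT.run ⟨.gl, none, none, sv⟩
        (gs.flatMap fun g => rep 2 (QGate.encode g) ++ [false, true]) =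
      (⟨.gl, none, none, sv'⟩, gs.flatMap gateToks) := by
  induction gs with
  | nil => intro sv; exact ⟨sv, rfl⟩
  | cons g gs ih =>
    intro sv
    rw [List.flatMap_cons, List.flatMap_cons]
    cases g with
    | gate g e =>
      obtain ⟨sv₁, h₁⟩ := run_gl_gateCode sv g e (gs.flatMap fun g => rep 2 (QGate.encode g) ++ [false, true])
      obtain ⟨sv₂, h₂⟩ := ih sv₁
      exact ⟨sv₂, by rw [h₁, h₂]⟩
    | oracle m e =>
      obtain ⟨sv₂, h₂⟩ := ih sv
      refine ⟨sv₂, ?_⟩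
      cases m with
      | zero => rw [run_gl_oracleCode sv 0 e, h₂]
      | succ m => rw [run_gl_oracleCode sv (m + 1) e, h₂]

/-- **The lexer on the code of an instance**: the unary numeral of `n`, a `0`, and the token
blocks of the gates. [cite: AaronsonAmbainis2018, §6 Thm. 25 (proof, p. 27)] -/
theorem eval_encode (I : QSimSignInstance) :
    lexT.eval I.encode = List.replicate I.n true ++ false :: I.circuit.gates.flatMap gateToks := by
  obtain ⟨sv', h⟩ := run_gl_gates I.circuit.gates SymV.s0
  have hin : I.encode = rep 2 (List.replicate I.n true) ++ (false :: true ::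
      (I.circuit.gates.flatMap fun g => rep 2 (QGate.encode g) ++ [false, true])) := by
    rw [QSimSignInstance.encode, boolPair_eq_rep, unaryEncodeNat_eq_replicate, QCircuit.encode_eq_encList,
      Com.encList_eq_flatMap, List.flatMap_map, List.append_assoc]
    rfl
  rw [FST.eval, hin]
  change List.nil ++ (if true = true then (lexT.run ⟨.pre, none, none, .s0⟩ _).2 else []) = _
  rw [if_pos rfl, List.nil_append, run_pre_replicate, run_pre_sep, h]

end Thm25Lex

end Literature.Computability.QuantumComplexity
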